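import Summits.QuantumFields.YangMills.Theorems.BalabanUVNodesK0TransportThirdMomentScalar

/-!
# K0⁷ ∕ NODE O lens-2 «flow-gronwall-ttel» — ONE ORDER ABOVE `Beta/DressedMomentNormalisation`, PART B (matrix kernels, `d = 4`, `wStep`): the decimated THIRD moment of the two-sided dressed kernel is transported
# EXACTLY (no aliasing remainder) under two-sided (L0∞)∕(L1∞) and (T0)∕(T1)∕(T2 = 0) — `Σ_z z_κ z_λ z_μ · N⁸·K_{ab}(N z) = N⁻¹ · M3_{κλμ}(T)_{ab}` in `d = 4`

Cell `pub-ymgap`, width seat `pub-ymgap-dag-n07-w3` (g18; N07 [B11] ∕ K0⁷–K1 junction; helper strictly BELOW the |β|-box stub of K0⁷ stmt-QuantumFields-20541).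
`--kind proof --supports stmt-QuantumFields-20541 --as helper`, COUNT-NEUTRAL.  NEW leaf; theorems only — 0 `def`, 0 `sorry`.  (Typed as a Literature/Beta sibling; homed under Theorems because
the gate keeps Literature∕ for PUBLISHED statements — this is [folklore] bookkeeping proved here.)

HONEST FRAMING (binding).  [folklore]
bookkeeping of absolutely convergent lattice sums over `ℝ`; NOTHING of the manuscripts under audit ([Balaban1987RG1] and companions) is asserted; no kernel of the record is touched.
Value = a kernel-checked identity that PRICES one channel of the NODE O cover's lens-2 «flow-gronwall-ttel» crux P-α (`Cruxes/Record13SepCoPHInhabited/Ideas/flow-gronwall-ttel.md`,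
CRIT-1 `…/CRIT-1-CUT1-lens2-flow-gronwall-ttel-v0.md` §2 S1 «odd moments: WardFree kills m₀, m₁, m₂, NOT m₃ … the generic rate on WardFree-as-typed is ρ = Lc⁻¹»; lens-2's own
«cheapest falsifier: the m₄ bookkeeping by hand∕in-tree one order above `hasSum_transport_m2Tensor` — does the identity carry an aliasing remainder?»).  ANSWER AT ORDER 3, PROVED:
NO aliasing remainder — for a Ward (T0)∕(T1) AND second-moment-free (T2 = 0) kernel `T`, dressed on BOTH sides by patterns reproducing constants and affine functions through `N•ℤ^d`
((L0∞)∕(L1∞) = Strang–Fix order 2, exactly what the tree proves for `wStep`: `constReproSum_wStep`, `linReproSum_wStep`), the `N•ℤ^d`-windowed THIRD moment of the dressed sum is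
`σ · m₃ · n₀` on the nose (all 26 other monomials of `(t + x − u)³` vanish FIBREWISE: the twenty with at most one `u` by the LEFT collapse against a vanishing `T`-moment, the six
with two `u`'s and the one with three by the RIGHT collapse — constants AND first moments of the right pattern — against `m₁ = 0` ∕ `m₀ = 0`).  Hence in `d = 4`, bond normalisation,
the by-value transport `K ↦ N⁸ · dressedEntry w K (N • ·)` maps the third-moment tensor to EXACTLY `N⁻¹` times itself on the Ward + m₂-free subspace: the `Lc⁻¹` channel of CRIT-1's
S1 is an exact eigen-relation (so lens-2's rate `ρ` can be `< Lc⁻¹` only on kernels with `M3 = 0`, e.g. under print's parity (5.8) on the DIAGONAL colour pairs — companion leaf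
`Thm/BalabanUVNodesK0TransportParity`), and aliasing through the Strang–Fix-2 weight can enter the moment jet only at order ≥ 4 (lens-2's toy: order 4, rate `1∕3` on even kernels).
P-α itself (a NORM contraction) is NOT touched; K0⁷ NOT closed; NODE O NOT inhabited; the Yang–Mills mass gap (Clay) is NOT proved by any of this.

WHAT IS PROVED HERE (all [folklore], over `ℝ`) — on top of PART A `Thm/BalabanUVNodesK0TransportThirdMomentScalar` (§1–§4 there: cubic engine, right collapse with an `x`-weight,
the 27-monomial identity `hasSum_term_third_of_vanishing`, the decimated-lattice form):
* (PART A) §1 cubic-weight summability: `summable_term_of_bound₃` (window bounded by `1`, weight `≤ B·(1+|u|₁³)(1+|t|₁³)(1+|x|₁³)`, factors with absolutely summable THIRD moments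
  `Summable ((1 + |y|₁³)·|f y|)`), the monomial bounds of degree `≤ 3`, `absMoment₂_of_absMoment₃`, and `absMoment₃_of_decay510` (a (5.10)-shape decay gives it).
* §2 `hasSum_term_rightW_of_zero` — the RIGHT collapse with an `x`-WEIGHT `r` reproduced through the window (`∀ a, Σ_x (χ(x−a)·r x) • w' x = ρ'`: (R0∞) for `r = 1`, (R1∞) for `r = x_i`)
  against a vanishing `T`-moment: the triple family sums to `0`.
* §3 `third_weight_expand` (the 27 monomials of `(t+x−u)_κ(t+x−u)_λ(t+x−u)_μ`) and ★ `hasSum_term_third_of_vanishing`: `Σ_{u,t,x} (χ(t+x−u)·(t+x−u)_κ(t+x−u)_λ(t+x−u)_μ) • (w u·T t·w' x)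
  = σ · m₃ · n₀`.
* §4 coarse ∕ decimated forms (`hasSum_coarse`, `hasSum_decimate_iff` of the sibling modules): `decimatedSum_third_moment_hasSum_lattice`.
* §5 matrix kernels: ★★ `thirdMoment_dressedEntry_hasSum_lattice` (spec normalisation, `N^{−(d+2)}·M3`), ★★ `bondThirdMoment_hasSum_four` (`d = 4`: `Σ_z z_κ z_λ z_μ · N⁸ K_{ab}(Nz) = N⁻¹·M3`),
  `absMoment₃_wStep`, and ★★★ `thirdMoment_transport_wStep` — the identity for lens-2's `transport Lc j K = fun a b z ↦ Lc⁸ · dressedEntry (wStep Lc j) K (Lc • z) a b` at EVERY level `j`.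

Companion leaf: `Thm/BalabanUVNodesK0TransportParity` (the parity (5.8) is transport-stable; diagonal odd moments vanish).  Version v1 (2026-08-30, dag-n07-w3 g18).  Imports `Beta.HessianTelescopingKKT` (for `wStep` and its reproduction data; brings `DressedMomentNormalisation`, `DecimatedMomentSummable`,
`DecimatedMomentLimit`).  No `sorry`, no `instance`, no `notation`, no new `def`.
-/

noncomputable section

namespace Summit.QuantumFields.YangMills.Theorems.K0TransportThirdMoment

open Finset Filter Topology
open Literature.MathematicalPhysics.QuantumFieldTheory.Balaban1983to89
open Literature.MathematicalPhysics.QuantumFieldTheory.Balaban1983to89.Beta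
open B12Sec2to5 (l1 l1_nonneg abs_coord_le_l1 Decay510 summable_exp_neg_l1)
open DecimatedMoment (cosetInd cosetInd_sub_comm)
open DecimatedMomentLimit (hasSum_decimate_iff abs_cosetInd_le_one)
open DecimatedMomentSummable
open DressedMomentNormalisation
open HessianTelescopingKKT (wStep constReproSum_wStep linReproSum_wStep)

open Summit.QuantumFields.YangMills.Theorems.K0TransportThirdMomentScalar

variable {d : ℕ}

/-! ## §5. Matrix kernels: the decimated third moment of an entry of the dressed kernel; `d = 4` bond normalisation; lens-2's transport at `wStep` -/

section Entry

variable {N : ℕ}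

/-- **THE DECIMATED THIRD MOMENT OF AN ENTRY OF THE DRESSED KERNEL** (spec normalisation).  Entrywise (L0∞) with the Kronecker masses `δ_{κl}·N^{−(d+1)}` and entrywise (L1∞) for `w`
(both used on the LEFT and on the RIGHT of the sandwich), entrywise (T0)∕(T1)∕(T2 = 0) for `T`, absolutely summable third moments: `z ↦ (N³ z_κ z_λ z_μ) • K_{ab}(N z)` has the sum
`N^{−(d+2)} · Σ'_t t_κ t_λ t_μ T a b t`. [folklore] -/
theorem thirdMoment_dressedEntry_hasSum_lattice (hN : 0 < N) (w T : EKer d)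
    (hw0 : ∀ κ l, ConstReproSum N (w κ l) (if κ = l then (((N : ℝ) ^ (d + 1))⁻¹) else 0))
    (hw1 : ∀ κ l, ∃ C : Fin d → ℝ, LinReproSum N (w κ l) C)
    (hw3 : ∀ κ l, Summable (fun y => (1 + l1 y ^ 3) * |w κ l y|)) (hT3 : ∀ c e, Summable (fun y => (1 + l1 y ^ 3) * |T c e y|))
    (hT0 : ∀ c e, HasSum (T c e) 0) (hT1 : ∀ c e (i : Fin d), HasSum (fun t => t i • T c e t) 0)
    (hT2 : ∀ c e (i j : Fin d), HasSum (fun t => (t i * t j) • T c e t) 0)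
    (κ lam μ a b : Fin d) :
    HasSum (fun z : Fin d → ℤ => ((N : ℤ) ^ 3 * (z κ * z lam * z μ)) • dressedEntry w T ((N : ℤ) • z) a b)
      ((((N : ℝ) ^ (d + 2))⁻¹) * ∑' t, (t κ * t lam * t μ) • T a b t) := by
  have hNne : N ≠ 0 := hN.ne'
  have hce : ∀ c e : Fin d,
      HasSum (fun z : Fin d → ℤ => ((N : ℤ) ^ 3 * (z κ * z lam * z μ)) • dressedSum (w c a) (T c e) (w e b) ((N : ℤ) • z))
        ((if c = a then (((N : ℝ) ^ (d + 1))⁻¹) else 0) * (∑' t, (t κ * t lam * t μ) • T c e t)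
          * ((N : ℝ) ^ d * (if e = b then (((N : ℝ) ^ (d + 1))⁻¹) else 0))) := by
    intro c e
    obtain ⟨C, hC⟩ := hw1 c a
    obtain ⟨C', hC'⟩ := hw1 e b
    have hsum3 : Summable (fun t => (t κ * t lam * t μ) • T c e t) := by
      refine Summable.of_norm_bounded (hT3 c e) (fun t => ?_)
      rw [Real.norm_eq_abs, zsmul_eq_mul, abs_mul]
      exact mul_le_mul_of_nonneg_right (abs_coord3_le_cube κ lam μ t) (abs_nonneg _)
    exact decimatedSum_third_moment_hasSum_lattice hNne (w c a) (T c e) (w e b) (hw0 c a) hC (hw0 e b) hC' κ lam μ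
      (hT0 c e) (hT1 c e) (hT2 c e) hsum3.hasSum (hasSum_total_of_constReproSum hN (hw0 e b)) (hw3 c a) (hT3 c e) (hw3 e b)
  have hs := hasSum_sum (s := (Finset.univ : Finset (Fin d)))
    (fun c _ => hasSum_sum (s := (Finset.univ : Finset (Fin d))) (fun e _ => hce c e))
  have hval : ∑ c, ∑ e, (if c = a then (((N : ℝ) ^ (d + 1))⁻¹) else 0) * (∑' t, (t κ * t lam * t μ) • T c e t)
        * ((N : ℝ) ^ d * (if e = b then (((N : ℝ) ^ (d + 1))⁻¹) else 0))
      = (((N : ℝ) ^ (d + 2))⁻¹) * ∑' t, (t κ * t lam * t μ) • T a b t := by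
    simp only [mul_ite, mul_zero, ite_mul, zero_mul, Finset.sum_ite_eq', Finset.mem_univ, if_true]
    have hN' : (N : ℝ) ≠ 0 := by exact_mod_cast hNne
    field_simp
    ring
  rw [hval] at hs
  refine hs.congr_fun (fun z => ?_)
  simp only [dressedEntry, Finset.smul_sum]

/-- **BOND NORMALISATION, `d = 4`: THE COARSE THIRD MOMENT IS EXACTLY `N⁻¹ · M3(T)`** — `Σ_z z_κ z_λ z_μ · (N⁸ · K_{ab}(N z)) = N⁻¹ · Σ'_t t_κ t_λ t_μ T a b t` at every block size
`N ≥ 1`; no estimate, no aliasing remainder (compare `bondSecondMoment_hasSum_four`: `N⁰`). [folklore] -/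
theorem bondThirdMoment_hasSum_four (hN : 0 < N) (w T : EKer 4)
    (hw0 : ∀ κ l, ConstReproSum N (w κ l) (if κ = l then (((N : ℝ) ^ (4 + 1))⁻¹) else 0))
    (hw1 : ∀ κ l, ∃ C : Fin 4 → ℝ, LinReproSum N (w κ l) C)
    (hw3 : ∀ κ l, Summable (fun y => (1 + l1 y ^ 3) * |w κ l y|)) (hT3 : ∀ c e, Summable (fun y => (1 + l1 y ^ 3) * |T c e y|))
    (hT0 : ∀ c e, HasSum (T c e) 0) (hT1 : ∀ c e (i : Fin 4), HasSum (fun t => t i • T c e t) 0)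
    (hT2 : ∀ c e (i j : Fin 4), HasSum (fun t => (t i * t j) • T c e t) 0)
    (κ lam μ a b : Fin 4) :
    HasSum (fun z : Fin 4 → ℤ => ((z κ * z lam * z μ : ℤ) : ℝ) * ((N : ℝ) ^ 8 * dressedEntry w T ((N : ℤ) • z) a b))
      (((N : ℝ))⁻¹ * ∑' t, (t κ * t lam * t μ) • T a b t) := by
  have hN' : (N : ℝ) ≠ 0 := by exact_mod_cast hN.ne'
  have h := (thirdMoment_dressedEntry_hasSum_lattice hN w T hw0 hw1 hw3 hT3 hT0 hT1 hT2 κ lam μ a b).mul_left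
    ((N : ℝ) ^ 8 / (N : ℝ) ^ 3)
  have hval : (N : ℝ) ^ 8 / (N : ℝ) ^ 3 * ((((N : ℝ) ^ (4 + 2))⁻¹) * ∑' t, (t κ * t lam * t μ) • T a b t)
      = ((N : ℝ))⁻¹ * ∑' t, (t κ * t lam * t μ) • T a b t := by
    field_simp
  rw [hval] at h
  refine h.congr_fun (fun z => ?_)
  simp only [zsmul_eq_mul, Int.cast_mul, Int.cast_pow, Int.cast_natCast]
  field_simp

end Entry

/-! ## §6. At the canonical weight `wStep Lc j` (lens-2's by-value transport `K ↦ Lc⁸ · dressedEntry (wStep Lc j) K (Lc • z)`) -/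

section Step

open OneStepKernelFamily (decays_KInvStep l1_neg_eq)
open HessianTelescopingKKT (stepCol)

variable {Lc : ℕ} [NeZero Lc]

/-- The `ℋ`-column pattern has an absolutely summable THIRD moment (exponential decay of `KInvStep`). [folklore] -/
theorem absMoment₃_stepCol (j : ℕ) (κ l : Fin (d + 1)) : Summable (fun y => (1 + l1 y ^ 3) * |stepCol (d := d) Lc j κ l y|) := by
  obtain ⟨δ, C, hδ, _, hK⟩ := decays_KInvStep (d := d) (Lc := Lc) j
  refine absMoment₃_of_decay510 hδ (C := C) fun p => ?_
  have h := hK (-p) 0 (Sum.inl κ) (Sum.inr l)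
  rw [sub_zero, l1_neg_eq] at h
  exact h

/-- `wStep Lc j` has absolutely summable THIRD moments, entrywise, at every level `j`. [folklore] -/
theorem absMoment₃_wStep (j : ℕ) (κ l : Fin 4) : Summable (fun y => (1 + l1 y ^ 3) * |wStep Lc j κ l y|) := by
  have h := (absMoment₃_stepCol (d := 3) (Lc := Lc) j κ l).mul_left (|(Lc : ℝ) ^ (5 * j)|)
  refine h.congr (fun y => ?_)
  simp only [wStep, abs_mul]
  ring

/-- **★★★ LENS-2's TRANSPORT MAPS THE THIRD-MOMENT TENSOR TO EXACTLY `Lc⁻¹` TIMES ITSELF ON THE WARD + m₂-FREE SUBSPACE, AT EVERY LEVEL `j`** — for a kernel `K` with (T0), (T1),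
(T2 = 0) and absolutely summable third moments: `Σ_z z_κ z_λ z_μ · (Lc⁸ · dressedEntry (wStep Lc j) K (Lc • z) a b) = Lc⁻¹ · Σ'_t t_κ t_λ t_μ K a b t` (the weight-side hypotheses are
the tree's `constReproSum_wStep`, `linReproSum_wStep`, `absMoment₃_wStep`).  So the `Lc⁻¹` channel of CRIT-1's S1 is an EXACT eigen-relation of the by-value transport on that subspace
(no aliasing at order 3); a rate `ρ < Lc⁻¹` in lens-2's P-α is possible only on kernels with `M3 = 0`.  P-α (a norm statement) is not touched. [folklore] -/
theorem thirdMoment_transport_wStep (j : ℕ) (K : EKer 4)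
    (hK3 : ∀ c e, Summable (fun y => (1 + l1 y ^ 3) * |K c e y|))
    (hT0 : ∀ c e, HasSum (K c e) 0) (hT1 : ∀ c e (i : Fin 4), HasSum (fun t => t i • K c e t) 0)
    (hT2 : ∀ c e (i j : Fin 4), HasSum (fun t => (t i * t j) • K c e t) 0)
    (κ lam μ a b : Fin 4) :
    HasSum (fun z : Fin 4 → ℤ => ((z κ * z lam * z μ : ℤ) : ℝ) * ((Lc : ℝ) ^ 8 * dressedEntry (wStep Lc j) K ((Lc : ℤ) • z) a b))
      (((Lc : ℝ))⁻¹ * ∑' t, (t κ * t lam * t μ) • K a b t) :=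
  bondThirdMoment_hasSum_four (Nat.pos_of_ne_zero (NeZero.ne Lc)) (wStep Lc j) K (fun κ l => constReproSum_wStep j κ l)
    (fun κ l => linReproSum_wStep j κ l) (fun κ l => absMoment₃_wStep j κ l) hK3 hT0 hT1 hT2 κ lam μ a b

/-- `tsum` form: `Σ'_z z_κ z_λ z_μ · (Lc⁸ · dressedEntry (wStep Lc j) K (Lc • z) a b) = Lc⁻¹ · M3_{κλμ}(K)_{ab}`. [folklore] -/
theorem thirdMoment_transport_wStep_tsum (j : ℕ) (K : EKer 4)
    (hK3 : ∀ c e, Summable (fun y => (1 + l1 y ^ 3) * |K c e y|))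
    (hT0 : ∀ c e, HasSum (K c e) 0) (hT1 : ∀ c e (i : Fin 4), HasSum (fun t => t i • K c e t) 0)
    (hT2 : ∀ c e (i j : Fin 4), HasSum (fun t => (t i * t j) • K c e t) 0)
    (κ lam μ a b : Fin 4) :
    ∑' z : Fin 4 → ℤ, ((z κ * z lam * z μ : ℤ) : ℝ) * ((Lc : ℝ) ^ 8 * dressedEntry (wStep Lc j) K ((Lc : ℤ) • z) a b)
      = ((Lc : ℝ))⁻¹ * ∑' t, (t κ * t lam * t μ) • K a b t :=
  (thirdMoment_transport_wStep j K hK3 hT0 hT1 hT2 κ lam μ a b).tsum_eq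

end Step

end Summit.QuantumFields.YangMills.Theorems.K0TransportThirdMoment

end
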